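import Summits.Ventures.QEC.Census.RankCert
import HarnessLib

/-!
# CSS census rows in the kernel (CalibCSSN05to06): exact `[[n, k, d]]`, `d^X`, `d^Z` for the calibCSS cells n = 5, 6

LADDER-QEC (venture cell `qec`), CENSUS-PREREG C.2 («all CSS codes from classical pairs `C₂^⊥ ⊆ C₁` … compared cell by
cell»; companion table census/search-5/css-n12/CSS-CALIB.tsv, qec-search-5: best CSS distance per cell `(n, k)`,
`n ≤ 12`, every instance certA ∧ certB ∧ ref-1 = tier COMPUTED in census/TABLE.tsv, family `calibCSS`, ids
`css_n<N>_k<K>`). This file is the KERNEL column of the LOWER half of those cells (existence with the exact parameters):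
for each row the CSS code (type-02 `CSSCode.ofMatrices`, Literature/…/CSS.lean) whose check matrices are the LITERAL gens
rows (`rowMatrix n <bitmasks>`, bit `j` = qubit `j` = character `j` of the gens string «leftmost = qubit 0») is proved
to be EXACTLY `[[n, k, d]]` (`CSSCode.IsCode`: `|Q| = n`, `k = n − rk H^X − rk H^Z`, `cssMinDist = d`) with its two
sector distances `d^X`, `d^Z`, by qec-type-10's distance-certificate checker `DistCert.checkDistCert`
(Census/CertCheck.lean: commutation, weight-`d` logical + non-membership witness, bruteforce replay of every word of
weight `< d` against the allow-list of low-weight stabilizers) and qec-type-02's rank certificates `RankCert.check`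
(Census/RankCert.lean), assembled by `DistCert.isCode_code`; every check is ONE `decide` (≤ 300-word replays) —
tier KERNEL-std, axioms ⊆ {propext, Classical.choice, Quot.sound}, no `native_decide`. The `k = 0` cells (CRSS
convention) and the UPPER half (no CSS `[[n, k, d+1]]`) are separate files. Certificates found and checked in-seat by
qec-type-02's `emit_css_calib.py` from the gens files alone (nothing from the producer is trusted: the kernel
recomputes every syndrome, weight, XOR and parity). HONEST FRAMING: these are statements about the 78 + 12 explicit
instances of the table, not about optimality; coverage of the cell grid is search-5's sentence (CSS-LP upper bounds,
COMPUTED), not claimed here. [folklore] throughout (elementary linear algebra over `𝔽₂`).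
-/

namespace Summit.Ventures.QEC.Census.CSS

open Summit.Ventures.QEC.Census Literature.InformationTheory.QuantumCodes

/-- Census row `css_n5_k1` (family `calibCSS`, CENSUS-PREREG C.2; gens census/search-5/css-n12/css_gens/css_n5_k1.txt, GENS-SHA matrix_sha256 `cb14af8330e3cdbb…`, file_sha16 `cc43424c30141c54`; certA `ffbe5d9d7f708e07` ∧ certB `6269253f43f3c34f`, ref-1 signed; search-5 provenance: short_j0Z(short_j0X([[7,1,3]] Steane (A=B=[7,3,4] simplex; Steane96)))). The CSS code with the LITERAL check rows `H^X = [21, 11]`, `H^Z = [25, 7]` (bitmasks, bit `j` = qubit `j` = character `j` of the gens string) is EXACTLY a `[[5, 1, 2]]` code (`d^X = 2`, `d^Z = 2`): distance certificate (type-10 `DistCert`, bruteforce replay of 10 words) + two rank certificates (type-02 `RankCert`, `r_X = 2`, `r_Z = 2`), all by `decide` — tier KERNEL-std. [folklore] -/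
theorem check_css_n5_k1 :
    ({ n := 5, HX := [21, 11], HZ := [25, 7],
        sideZ := { d := 2, witness := 10, nonmember := 6, found := [] },
        sideX := { d := 2, witness := 6, nonmember := 10, found := [] } } : DistCert).checkDistCert = true := by
  decide

/-- Rank certificate of `H^X` of `css_n5_k1` accepted (`rank = 2`, `decide`). [folklore] -/
theorem rankX_css_n5_k1 : ({ r := 2, pivots := [0, 1], rinv := [3, 2], dependent := [] } : RankCert).check 5 [21, 11] = true := by
  decide

/-- Rank certificate of `H^Z` of `css_n5_k1` accepted (`rank = 2`, `decide`). [folklore] -/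
theorem rankZ_css_n5_k1 : ({ r := 2, pivots := [0, 1], rinv := [3, 2], dependent := [] } : RankCert).check 5 [25, 7] = true := by
  decide

/-- **`css_n5_k1` is a `[[5, 1, 2]]` CSS code** (exact parameters, `CSSCode.IsCode`; KERNEL-std). [folklore] -/
theorem isCode_css_n5_k1 :
    (CSSCode.ofMatrices (rowMatrix 5 [21, 11]) (rowMatrix 5 [25, 7])
      (comm_of_commOK (DistCert.commOK_of_check _ check_css_n5_k1))).IsCode 5 1 2 :=
  DistCert.isCode_code _ check_css_n5_k1 rankX_css_n5_k1 rankZ_css_n5_k1 (by decide)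

/-- `d^X = 2` for `css_n5_k1` (KERNEL-std). [folklore] -/
theorem dX_css_n5_k1 :
    (CSSCode.ofMatrices (rowMatrix 5 [21, 11]) (rowMatrix 5 [25, 7])
      (comm_of_commOK (DistCert.commOK_of_check _ check_css_n5_k1))).dX = 2 :=
  DistCert.dX_code _ check_css_n5_k1

/-- `d^Z = 2` for `css_n5_k1` (KERNEL-std). [folklore] -/
theorem dZ_css_n5_k1 :
    (CSSCode.ofMatrices (rowMatrix 5 [21, 11]) (rowMatrix 5 [25, 7])
      (comm_of_commOK (DistCert.commOK_of_check _ check_css_n5_k1))).dZ = 2 :=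
  DistCert.dZ_code _ check_css_n5_k1

/-- Census row `css_n5_k2` (family `calibCSS`, CENSUS-PREREG C.2; gens census/search-5/css-n12/css_gens/css_n5_k2.txt, GENS-SHA matrix_sha256 `106ef9b4d5fb111e…`, file_sha16 `49b210941cdeaa4d`; certA `7ab2d8890415c85b` ∧ certB `e2b4fec6d195f893`, ref-1 signed; search-5 provenance: ext([[4,2,2]] A=B=<1^n>)). The CSS code with the LITERAL check rows `H^X = [15]`, `H^Z = [16, 15]` (bitmasks, bit `j` = qubit `j` = character `j` of the gens string) is EXACTLY a `[[5, 2, 2]]` code (`d^X = 2`, `d^Z = 2`): distance certificate (type-10 `DistCert`, bruteforce replay of 10 words) + two rank certificates (type-02 `RankCert`, `r_X = 1`, `r_Z = 2`), all by `decide` — tier KERNEL-std. [folklore] -/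
theorem check_css_n5_k2 :
    ({ n := 5, HX := [15], HZ := [16, 15],
        sideZ := { d := 2, witness := 3, nonmember := 5, found := [(16, [0])] },
        sideX := { d := 2, witness := 3, nonmember := 5, found := [] } } : DistCert).checkDistCert = true := by
  decide

/-- Rank certificate of `H^X` of `css_n5_k2` accepted (`rank = 1`, `decide`). [folklore] -/
theorem rankX_css_n5_k2 : ({ r := 1, pivots := [0], rinv := [1], dependent := [] } : RankCert).check 5 [15] = true := by
  decide

/-- Rank certificate of `H^Z` of `css_n5_k2` accepted (`rank = 2`, `decide`). [folklore] -/
theorem rankZ_css_n5_k2 : ({ r := 2, pivots := [0, 1], rinv := [16, 1], dependent := [] } : RankCert).check 5 [16, 15] = true := by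
  decide

/-- **`css_n5_k2` is a `[[5, 2, 2]]` CSS code** (exact parameters, `CSSCode.IsCode`; KERNEL-std). [folklore] -/
theorem isCode_css_n5_k2 :
    (CSSCode.ofMatrices (rowMatrix 5 [15]) (rowMatrix 5 [16, 15])
      (comm_of_commOK (DistCert.commOK_of_check _ check_css_n5_k2))).IsCode 5 2 2 :=
  DistCert.isCode_code _ check_css_n5_k2 rankX_css_n5_k2 rankZ_css_n5_k2 (by decide)

/-- `d^X = 2` for `css_n5_k2` (KERNEL-std). [folklore] -/
theorem dX_css_n5_k2 :
    (CSSCode.ofMatrices (rowMatrix 5 [15]) (rowMatrix 5 [16, 15])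
      (comm_of_commOK (DistCert.commOK_of_check _ check_css_n5_k2))).dX = 2 :=
  DistCert.dX_code _ check_css_n5_k2

/-- `d^Z = 2` for `css_n5_k2` (KERNEL-std). [folklore] -/
theorem dZ_css_n5_k2 :
    (CSSCode.ofMatrices (rowMatrix 5 [15]) (rowMatrix 5 [16, 15])
      (comm_of_commOK (DistCert.commOK_of_check _ check_css_n5_k2))).dZ = 2 :=
  DistCert.dZ_code _ check_css_n5_k2

/-- Census row `css_n5_k3` (family `calibCSS`, CENSUS-PREREG C.2; gens census/search-5/css-n12/css_gens/css_n5_k3.txt, GENS-SHA matrix_sha256 `cd2ae2bfc9d6ae4c…`, file_sha16 `7b9c3fa3359e3e33`; certA `7421ddce5d45d500` ∧ certB `c8d7e1f7e751d738`, ref-1 signed; search-5 provenance: trivial CSS [[5,3,1]]). The CSS code with the LITERAL check rows `H^X = []`, `H^Z = [2, 1]` (bitmasks, bit `j` = qubit `j` = character `j` of the gens string) is EXACTLY a `[[5, 3, 1]]` code (`d^X = 1`, `d^Z = 1`): distance certificate (type-10 `DistCert`, bruteforce replay of 0 words) + two rank certificates (type-02 `RankCert`, `r_X = 0`, `r_Z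 = 2`), all by `decide` — tier KERNEL-std. [folklore] -/
theorem check_css_n5_k3 :
    ({ n := 5, HX := [], HZ := [2, 1],
        sideZ := { d := 1, witness := 4, nonmember := 4, found := [] },
        sideX := { d := 1, witness := 4, nonmember := 4, found := [] } } : DistCert).checkDistCert = true := by
  decide

/-- Rank certificate of `H^X` of `css_n5_k3` accepted (`rank = 0`, `decide`). [folklore] -/
theorem rankX_css_n5_k3 : ({ r := 0, pivots := [], rinv := [], dependent := [] } : RankCert).check 5 [] = true := by
  decide

/-- Rank certificate of `H^Z` of `css_n5_k3` accepted (`rank = 2`, `decide`). [folklore] -/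
theorem rankZ_css_n5_k3 : ({ r := 2, pivots := [0, 1], rinv := [2, 1], dependent := [] } : RankCert).check 5 [2, 1] = true := by
  decide

/-- **`css_n5_k3` is a `[[5, 3, 1]]` CSS code** (exact parameters, `CSSCode.IsCode`; KERNEL-std). [folklore] -/
theorem isCode_css_n5_k3 :
    (CSSCode.ofMatrices (rowMatrix 5 []) (rowMatrix 5 [2, 1])
      (comm_of_commOK (DistCert.commOK_of_check _ check_css_n5_k3))).IsCode 5 3 1 :=
  DistCert.isCode_code _ check_css_n5_k3 rankX_css_n5_k3 rankZ_css_n5_k3 (by decide)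

/-- `d^X = 1` for `css_n5_k3` (KERNEL-std). [folklore] -/
theorem dX_css_n5_k3 :
    (CSSCode.ofMatrices (rowMatrix 5 []) (rowMatrix 5 [2, 1])
      (comm_of_commOK (DistCert.commOK_of_check _ check_css_n5_k3))).dX = 1 :=
  DistCert.dX_code _ check_css_n5_k3

/-- `d^Z = 1` for `css_n5_k3` (KERNEL-std). [folklore] -/
theorem dZ_css_n5_k3 :
    (CSSCode.ofMatrices (rowMatrix 5 []) (rowMatrix 5 [2, 1])
      (comm_of_commOK (DistCert.commOK_of_check _ check_css_n5_k3))).dZ = 1 :=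
  DistCert.dZ_code _ check_css_n5_k3

/-- Census row `css_n5_k4` (family `calibCSS`, CENSUS-PREREG C.2; gens census/search-5/css-n12/css_gens/css_n5_k4.txt, GENS-SHA matrix_sha256 `a36d255a43470ab1…`, file_sha16 `057ba0ac1e654360`; certA `f4242d5aad227c6f` ∧ certB `c0f9638e547461eb`, ref-1 signed; search-5 provenance: trivial CSS [[5,4,1]]). The CSS code with the LITERAL check rows `H^X = []`, `H^Z = [1]` (bitmasks, bit `j` = qubit `j` = character `j` of the gens string) is EXACTLY a `[[5, 4, 1]]` code (`d^X = 1`, `d^Z = 1`): distance certificate (type-10 `DistCert`, bruteforce replay of 0 words) + two rank certificates (type-02 `RankCert`, `r_X = 0`, `r_Z = 1`), all by `decide` — tier KERNEL-std. [folklore] -/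
theorem check_css_n5_k4 :
    ({ n := 5, HX := [], HZ := [1],
        sideZ := { d := 1, witness := 2, nonmember := 2, found := [] },
        sideX := { d := 1, witness := 2, nonmember := 2, found := [] } } : DistCert).checkDistCert = true := by
  decide

/-- Rank certificate of `H^X` of `css_n5_k4` accepted (`rank = 0`, `decide`). [folklore] -/
theorem rankX_css_n5_k4 : ({ r := 0, pivots := [], rinv := [], dependent := [] } : RankCert).check 5 [] = true := by
  decide

/-- Rank certificate of `H^Z` of `css_n5_k4` accepted (`rank = 1`, `decide`). [folklore] -/
theorem rankZ_css_n5_k4 : ({ r := 1, pivots := [0], rinv := [1], dependent := [] } : RankCert).check 5 [1] = true := by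
  decide

/-- **`css_n5_k4` is a `[[5, 4, 1]]` CSS code** (exact parameters, `CSSCode.IsCode`; KERNEL-std). [folklore] -/
theorem isCode_css_n5_k4 :
    (CSSCode.ofMatrices (rowMatrix 5 []) (rowMatrix 5 [1])
      (comm_of_commOK (DistCert.commOK_of_check _ check_css_n5_k4))).IsCode 5 4 1 :=
  DistCert.isCode_code _ check_css_n5_k4 rankX_css_n5_k4 rankZ_css_n5_k4 (by decide)

/-- `d^X = 1` for `css_n5_k4` (KERNEL-std). [folklore] -/
theorem dX_css_n5_k4 :
    (CSSCode.ofMatrices (rowMatrix 5 []) (rowMatrix 5 [1])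
      (comm_of_commOK (DistCert.commOK_of_check _ check_css_n5_k4))).dX = 1 :=
  DistCert.dX_code _ check_css_n5_k4

/-- `d^Z = 1` for `css_n5_k4` (KERNEL-std). [folklore] -/
theorem dZ_css_n5_k4 :
    (CSSCode.ofMatrices (rowMatrix 5 []) (rowMatrix 5 [1])
      (comm_of_commOK (DistCert.commOK_of_check _ check_css_n5_k4))).dZ = 1 :=
  DistCert.dZ_code _ check_css_n5_k4

/-- Census row `css_n5_k5` (family `calibCSS`, CENSUS-PREREG C.2; gens census/search-5/css-n12/css_gens/css_n5_k5.txt, GENS-SHA matrix_sha256 `7f9f44f14f5aea52…`, file_sha16 `f6fe141fa01ecd10`; certA `352e08f888c77124` ∧ certB `bc084e6748d3dcb2`, ref-1 signed; search-5 provenance: trivial CSS [[5,5,1]]). The CSS code with the LITERAL check rows `H^X = []`, `H^Z = []` (bitmasks, bit `j` = qubit `j` = character `j` of the gens string) is EXACTLY a `[[5, 5, 1]]` code (`d^X = 1`, `d^Z = 1`): distance certificate (type-10 `DistCert`, bruteforce replay of 0 words) + two rank certificates (type-02 `RankCert`, `r_X = 0`, `r_Z = 0`), all by `decide` — tier KERNEL-std.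 [folklore] -/
theorem check_css_n5_k5 :
    ({ n := 5, HX := [], HZ := [],
        sideZ := { d := 1, witness := 1, nonmember := 1, found := [] },
        sideX := { d := 1, witness := 1, nonmember := 1, found := [] } } : DistCert).checkDistCert = true := by
  decide

/-- Rank certificate of `H^X` of `css_n5_k5` accepted (`rank = 0`, `decide`). [folklore] -/
theorem rankX_css_n5_k5 : ({ r := 0, pivots := [], rinv := [], dependent := [] } : RankCert).check 5 [] = true := by
  decide

/-- Rank certificate of `H^Z` of `css_n5_k5` accepted (`rank = 0`, `decide`). [folklore] -/
theorem rankZ_css_n5_k5 : ({ r := 0, pivots := [], rinv := [], dependent := [] } : RankCert).check 5 [] = true := by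
  decide

/-- **`css_n5_k5` is a `[[5, 5, 1]]` CSS code** (exact parameters, `CSSCode.IsCode`; KERNEL-std). [folklore] -/
theorem isCode_css_n5_k5 :
    (CSSCode.ofMatrices (rowMatrix 5 []) (rowMatrix 5 [])
      (comm_of_commOK (DistCert.commOK_of_check _ check_css_n5_k5))).IsCode 5 5 1 :=
  DistCert.isCode_code _ check_css_n5_k5 rankX_css_n5_k5 rankZ_css_n5_k5 (by decide)

/-- `d^X = 1` for `css_n5_k5` (KERNEL-std). [folklore] -/
theorem dX_css_n5_k5 :
    (CSSCode.ofMatrices (rowMatrix 5 []) (rowMatrix 5 [])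
      (comm_of_commOK (DistCert.commOK_of_check _ check_css_n5_k5))).dX = 1 :=
  DistCert.dX_code _ check_css_n5_k5

/-- `d^Z = 1` for `css_n5_k5` (KERNEL-std). [folklore] -/
theorem dZ_css_n5_k5 :
    (CSSCode.ofMatrices (rowMatrix 5 []) (rowMatrix 5 [])
      (comm_of_commOK (DistCert.commOK_of_check _ check_css_n5_k5))).dZ = 1 :=
  DistCert.dZ_code _ check_css_n5_k5

/-- Census row `css_n6_k1` (family `calibCSS`, CENSUS-PREREG C.2; gens census/search-5/css-n12/css_gens/css_n6_k1.txt, GENS-SHA matrix_sha256 `80a7184582f4c6be…`, file_sha16 `63bd14fb207aecfe`; certA `9151979373053bdb` ∧ certB `71596747caada766`, ref-1 signed; search-5 provenance: short_j0X([[7,1,3]] Steane (A=B=[7,3,4] simplex; Steane96))). The CSS code with the LITERAL check rows `H^X = [37, 22, 15]`, `H^Z = [51, 15]` (bitmasks, bit `j` = qubit `j` = character `j` of the gens string) is EXACTLY a `[[6, 1, 2]]` code (`d^X = 2`, `d^Z = 3`): distance certificate (type-10 `DistCert`, bruteforce replay of 27 words) + two rank certificates (type-02 `RankCert`, `r_X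 = 3`, `r_Z = 2`), all by `decide` — tier KERNEL-std. [folklore] -/
theorem check_css_n6_k1 :
    ({ n := 6, HX := [37, 22, 15], HZ := [51, 15],
        sideZ := { d := 3, witness := 21, nonmember := 3, found := [] },
        sideX := { d := 2, witness := 3, nonmember := 21, found := [] } } : DistCert).checkDistCert = true := by
  decide

/-- Rank certificate of `H^X` of `css_n6_k1` accepted (`rank = 3`, `decide`). [folklore] -/
theorem rankX_css_n6_k1 : ({ r := 3, pivots := [0, 1, 2], rinv := [6, 5, 7], dependent := [] } : RankCert).check 6 [37, 22, 15] = true := by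
  decide

/-- Rank certificate of `H^Z` of `css_n6_k1` accepted (`rank = 2`, `decide`). [folklore] -/
theorem rankZ_css_n6_k1 : ({ r := 2, pivots := [0, 1], rinv := [5, 4], dependent := [] } : RankCert).check 6 [51, 15] = true := by
  decide

/-- **`css_n6_k1` is a `[[6, 1, 2]]` CSS code** (exact parameters, `CSSCode.IsCode`; KERNEL-std). [folklore] -/
theorem isCode_css_n6_k1 :
    (CSSCode.ofMatrices (rowMatrix 6 [37, 22, 15]) (rowMatrix 6 [51, 15])
      (comm_of_commOK (DistCert.commOK_of_check _ check_css_n6_k1))).IsCode 6 1 2 :=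
  DistCert.isCode_code _ check_css_n6_k1 rankX_css_n6_k1 rankZ_css_n6_k1 (by decide)

/-- `d^X = 2` for `css_n6_k1` (KERNEL-std). [folklore] -/
theorem dX_css_n6_k1 :
    (CSSCode.ofMatrices (rowMatrix 6 [37, 22, 15]) (rowMatrix 6 [51, 15])
      (comm_of_commOK (DistCert.commOK_of_check _ check_css_n6_k1))).dX = 2 :=
  DistCert.dX_code _ check_css_n6_k1

/-- `d^Z = 3` for `css_n6_k1` (KERNEL-std). [folklore] -/
theorem dZ_css_n6_k1 :
    (CSSCode.ofMatrices (rowMatrix 6 [37, 22, 15]) (rowMatrix 6 [51, 15])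
      (comm_of_commOK (DistCert.commOK_of_check _ check_css_n6_k1))).dZ = 3 :=
  DistCert.dZ_code _ check_css_n6_k1

/-- Census row `css_n6_k2` (family `calibCSS`, CENSUS-PREREG C.2; gens census/search-5/css-n12/css_gens/css_n6_k2.txt, GENS-SHA matrix_sha256 `86a781e8f0198ee9…`, file_sha16 `f6026e4bfc2ccb37`; certA `4ae716b680144fd8` ∧ certB `3bb397b05a60e58b`, ref-1 signed; search-5 provenance: punct_j0([[7,1,3]] Steane (A=B=[7,3,4] simplex; Steane96))). The CSS code with the LITERAL check rows `H^X = [51, 15]`, `H^Z = [51, 15]` (bitmasks, bit `j` = qubit `j` = character `j` of the gens string) is EXACTLY a `[[6, 2, 2]]` code (`d^X = 2`, `d^Z = 2`): distance certificate (type-10 `DistCert`, bruteforce replay of 12 words) + two rank certificates (type-02 `RankCert`, `r_X = 2`, `r_Z = 2`), all by `decide` — tier KERNEL-std. [folklore] -/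
theorem check_css_n6_k2 :
    ({ n := 6, HX := [51, 15], HZ := [51, 15],
        sideZ := { d := 2, witness := 3, nonmember := 21, found := [] },
        sideX := { d := 2, witness := 3, nonmember := 21, found := [] } } : DistCert).checkDistCert = true := by
  decide

/-- Rank certificate of `H^X` of `css_n6_k2` accepted (`rank = 2`, `decide`). [folklore] -/
theorem rankX_css_n6_k2 : ({ r := 2, pivots := [0, 1], rinv := [5, 4], dependent := [] } : RankCert).check 6 [51, 15] = true := by
  decide

/-- Rank certificate of `H^Z` of `css_n6_k2` accepted (`rank = 2`, `decide`). [folklore] -/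
theorem rankZ_css_n6_k2 : ({ r := 2, pivots := [0, 1], rinv := [5, 4], dependent := [] } : RankCert).check 6 [51, 15] = true := by
  decide

/-- **`css_n6_k2` is a `[[6, 2, 2]]` CSS code** (exact parameters, `CSSCode.IsCode`; KERNEL-std). [folklore] -/
theorem isCode_css_n6_k2 :
    (CSSCode.ofMatrices (rowMatrix 6 [51, 15]) (rowMatrix 6 [51, 15])
      (comm_of_commOK (DistCert.commOK_of_check _ check_css_n6_k2))).IsCode 6 2 2 :=
  DistCert.isCode_code _ check_css_n6_k2 rankX_css_n6_k2 rankZ_css_n6_k2 (by decide)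

/-- `d^X = 2` for `css_n6_k2` (KERNEL-std). [folklore] -/
theorem dX_css_n6_k2 :
    (CSSCode.ofMatrices (rowMatrix 6 [51, 15]) (rowMatrix 6 [51, 15])
      (comm_of_commOK (DistCert.commOK_of_check _ check_css_n6_k2))).dX = 2 :=
  DistCert.dX_code _ check_css_n6_k2

/-- `d^Z = 2` for `css_n6_k2` (KERNEL-std). [folklore] -/
theorem dZ_css_n6_k2 :
    (CSSCode.ofMatrices (rowMatrix 6 [51, 15]) (rowMatrix 6 [51, 15])
      (comm_of_commOK (DistCert.commOK_of_check _ check_css_n6_k2))).dZ = 2 :=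
  DistCert.dZ_code _ check_css_n6_k2

/-- Census row `css_n6_k3` (family `calibCSS`, CENSUS-PREREG C.2; gens census/search-5/css-n12/css_gens/css_n6_k3.txt, GENS-SHA matrix_sha256 `536fdc1d83c5418b…`, file_sha16 `d8932fcc9d2bbeec`; certA `767f3623cd28f7fd` ∧ certB `63fe3671b169a8d9`, ref-1 signed; search-5 provenance: sub0([[6,4,2]] A=B=<1^n>)). The CSS code with the LITERAL check rows `H^X = [63]`, `H^Z = [34, 29]` (bitmasks, bit `j` = qubit `j` = character `j` of the gens string) is EXACTLY a `[[6, 3, 2]]` code (`d^X = 2`, `d^Z = 2`): distance certificate (type-10 `DistCert`, bruteforce replay of 12 words) + two rank certificates (type-02 `RankCert`, `r_X = 1`, `r_Z = 2`), all by `decide` — tier KERNEL-std. [folklore] -/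
theorem check_css_n6_k3 :
    ({ n := 6, HX := [63], HZ := [34, 29],
        sideZ := { d := 2, witness := 3, nonmember := 5, found := [] },
        sideX := { d := 2, witness := 5, nonmember := 3, found := [] } } : DistCert).checkDistCert = true := by
  decide

/-- Rank certificate of `H^X` of `css_n6_k3` accepted (`rank = 1`, `decide`). [folklore] -/
theorem rankX_css_n6_k3 : ({ r := 1, pivots := [0], rinv := [1], dependent := [] } : RankCert).check 6 [63] = true := by
  decide

/-- Rank certificate of `H^Z` of `css_n6_k3` accepted (`rank = 2`, `decide`). [folklore] -/
theorem rankZ_css_n6_k3 : ({ r := 2, pivots := [0, 1], rinv := [2, 1], dependent := [] } : RankCert).check 6 [34, 29] = true := by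
  decide

/-- **`css_n6_k3` is a `[[6, 3, 2]]` CSS code** (exact parameters, `CSSCode.IsCode`; KERNEL-std). [folklore] -/
theorem isCode_css_n6_k3 :
    (CSSCode.ofMatrices (rowMatrix 6 [63]) (rowMatrix 6 [34, 29])
      (comm_of_commOK (DistCert.commOK_of_check _ check_css_n6_k3))).IsCode 6 3 2 :=
  DistCert.isCode_code _ check_css_n6_k3 rankX_css_n6_k3 rankZ_css_n6_k3 (by decide)

/-- `d^X = 2` for `css_n6_k3` (KERNEL-std). [folklore] -/
theorem dX_css_n6_k3 :
    (CSSCode.ofMatrices (rowMatrix 6 [63]) (rowMatrix 6 [34, 29])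
      (comm_of_commOK (DistCert.commOK_of_check _ check_css_n6_k3))).dX = 2 :=
  DistCert.dX_code _ check_css_n6_k3

/-- `d^Z = 2` for `css_n6_k3` (KERNEL-std). [folklore] -/
theorem dZ_css_n6_k3 :
    (CSSCode.ofMatrices (rowMatrix 6 [63]) (rowMatrix 6 [34, 29])
      (comm_of_commOK (DistCert.commOK_of_check _ check_css_n6_k3))).dZ = 2 :=
  DistCert.dZ_code _ check_css_n6_k3

/-- Census row `css_n6_k4` (family `calibCSS`, CENSUS-PREREG C.2; gens census/search-5/css-n12/css_gens/css_n6_k4.txt, GENS-SHA matrix_sha256 `112255e129c708c3…`, file_sha16 `97df101111476dba`; certA `b22b57d55d22370d` ∧ certB `36177e8917902516`, ref-1 signed; search-5 provenance: [[6,4,2]] A=B=<1^n>). The CSS code with the LITERAL check rows `H^X = [63]`, `H^Z = [63]` (bitmasks, bit `j` = qubit `j` = character `j` of the gens string) is EXACTLY a `[[6, 4, 2]]` code (`d^X = 2`, `d^Z = 2`): distance certificate (type-10 `DistCert`, bruteforce replay of 12 words) + two rank certificates (type-02 `RankCert`, `r_X = 1`, `r_Z = 1`), all by `decide` — tier KERNEL-std.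 [folklore] -/
theorem check_css_n6_k4 :
    ({ n := 6, HX := [63], HZ := [63],
        sideZ := { d := 2, witness := 3, nonmember := 5, found := [] },
        sideX := { d := 2, witness := 3, nonmember := 5, found := [] } } : DistCert).checkDistCert = true := by
  decide

/-- Rank certificate of `H^X` of `css_n6_k4` accepted (`rank = 1`, `decide`). [folklore] -/
theorem rankX_css_n6_k4 : ({ r := 1, pivots := [0], rinv := [1], dependent := [] } : RankCert).check 6 [63] = true := by
  decide

/-- Rank certificate of `H^Z` of `css_n6_k4` accepted (`rank = 1`, `decide`). [folklore] -/
theorem rankZ_css_n6_k4 : ({ r := 1, pivots := [0], rinv := [1], dependent := [] } : RankCert).check 6 [63] = true := by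
  decide

/-- **`css_n6_k4` is a `[[6, 4, 2]]` CSS code** (exact parameters, `CSSCode.IsCode`; KERNEL-std). [folklore] -/
theorem isCode_css_n6_k4 :
    (CSSCode.ofMatrices (rowMatrix 6 [63]) (rowMatrix 6 [63])
      (comm_of_commOK (DistCert.commOK_of_check _ check_css_n6_k4))).IsCode 6 4 2 :=
  DistCert.isCode_code _ check_css_n6_k4 rankX_css_n6_k4 rankZ_css_n6_k4 (by decide)

/-- `d^X = 2` for `css_n6_k4` (KERNEL-std). [folklore] -/
theorem dX_css_n6_k4 :
    (CSSCode.ofMatrices (rowMatrix 6 [63]) (rowMatrix 6 [63])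
      (comm_of_commOK (DistCert.commOK_of_check _ check_css_n6_k4))).dX = 2 :=
  DistCert.dX_code _ check_css_n6_k4

/-- `d^Z = 2` for `css_n6_k4` (KERNEL-std). [folklore] -/
theorem dZ_css_n6_k4 :
    (CSSCode.ofMatrices (rowMatrix 6 [63]) (rowMatrix 6 [63])
      (comm_of_commOK (DistCert.commOK_of_check _ check_css_n6_k4))).dZ = 2 :=
  DistCert.dZ_code _ check_css_n6_k4

/-- Census row `css_n6_k5` (family `calibCSS`, CENSUS-PREREG C.2; gens census/search-5/css-n12/css_gens/css_n6_k5.txt, GENS-SHA matrix_sha256 `0c96c6f5850d51e0…`, file_sha16 `ec8dfb7ca49f3203`; certA `20226ef65bf0b2c7` ∧ certB `62c74c8be92578a2`, ref-1 signed; search-5 provenance: trivial CSS [[6,5,1]]). The CSS code with the LITERAL check rows `H^X = []`, `H^Z = [1]` (bitmasks, bit `j` = qubit `j` = character `j` of the gens string) is EXACTLY a `[[6, 5, 1]]` code (`d^X = 1`, `d^Z = 1`): distance certificate (type-10 `DistCert`, bruteforce replay of 0 words) + two rank certificates (type-02 `RankCert`, `r_X = 0`, `r_Z = 1`), all by `decide`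 — tier KERNEL-std. [folklore] -/
theorem check_css_n6_k5 :
    ({ n := 6, HX := [], HZ := [1],
        sideZ := { d := 1, witness := 2, nonmember := 2, found := [] },
        sideX := { d := 1, witness := 2, nonmember := 2, found := [] } } : DistCert).checkDistCert = true := by
  decide

/-- Rank certificate of `H^X` of `css_n6_k5` accepted (`rank = 0`, `decide`). [folklore] -/
theorem rankX_css_n6_k5 : ({ r := 0, pivots := [], rinv := [], dependent := [] } : RankCert).check 6 [] = true := by
  decide

/-- Rank certificate of `H^Z` of `css_n6_k5` accepted (`rank = 1`, `decide`). [folklore] -/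
theorem rankZ_css_n6_k5 : ({ r := 1, pivots := [0], rinv := [1], dependent := [] } : RankCert).check 6 [1] = true := by
  decide

/-- **`css_n6_k5` is a `[[6, 5, 1]]` CSS code** (exact parameters, `CSSCode.IsCode`; KERNEL-std). [folklore] -/
theorem isCode_css_n6_k5 :
    (CSSCode.ofMatrices (rowMatrix 6 []) (rowMatrix 6 [1])
      (comm_of_commOK (DistCert.commOK_of_check _ check_css_n6_k5))).IsCode 6 5 1 :=
  DistCert.isCode_code _ check_css_n6_k5 rankX_css_n6_k5 rankZ_css_n6_k5 (by decide)

/-- `d^X = 1` for `css_n6_k5` (KERNEL-std). [folklore] -/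
theorem dX_css_n6_k5 :
    (CSSCode.ofMatrices (rowMatrix 6 []) (rowMatrix 6 [1])
      (comm_of_commOK (DistCert.commOK_of_check _ check_css_n6_k5))).dX = 1 :=
  DistCert.dX_code _ check_css_n6_k5

/-- `d^Z = 1` for `css_n6_k5` (KERNEL-std). [folklore] -/
theorem dZ_css_n6_k5 :
    (CSSCode.ofMatrices (rowMatrix 6 []) (rowMatrix 6 [1])
      (comm_of_commOK (DistCert.commOK_of_check _ check_css_n6_k5))).dZ = 1 :=
  DistCert.dZ_code _ check_css_n6_k5

/-- Census row `css_n6_k6` (family `calibCSS`, CENSUS-PREREG C.2; gens census/search-5/css-n12/css_gens/css_n6_k6.txt, GENS-SHA matrix_sha256 `6237dcdde9db304a…`, file_sha16 `d75de70f1cc0a1da`; certA `d2f969c36873284a` ∧ certB `4d33ae1a60347ee2`, ref-1 signed; search-5 provenance: trivial CSS [[6,6,1]]). The CSS code with the LITERAL check rows `H^X = []`, `H^Z = []` (bitmasks, bit `j` = qubit `j` = character `j` of the gens string) is EXACTLY a `[[6, 6, 1]]` code (`d^X = 1`, `d^Z = 1`): distance certificate (type-10 `DistCert`, bruteforce replay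 of 0 words) + two rank certificates (type-02 `RankCert`, `r_X = 0`, `r_Z = 0`), all by `decide` — tier KERNEL-std. [folklore] -/
theorem check_css_n6_k6 :
    ({ n := 6, HX := [], HZ := [],
        sideZ := { d := 1, witness := 1, nonmember := 1, found := [] },
        sideX := { d := 1, witness := 1, nonmember := 1, found := [] } } : DistCert).checkDistCert = true := by
  decide

/-- Rank certificate of `H^X` of `css_n6_k6` accepted (`rank = 0`, `decide`). [folklore] -/
theorem rankX_css_n6_k6 : ({ r := 0, pivots := [], rinv := [], dependent := [] } : RankCert).check 6 [] = true := by
  decide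

/-- Rank certificate of `H^Z` of `css_n6_k6` accepted (`rank = 0`, `decide`). [folklore] -/
theorem rankZ_css_n6_k6 : ({ r := 0, pivots := [], rinv := [], dependent := [] } : RankCert).check 6 [] = true := by
  decide

/-- **`css_n6_k6` is a `[[6, 6, 1]]` CSS code** (exact parameters, `CSSCode.IsCode`; KERNEL-std). [folklore] -/
theorem isCode_css_n6_k6 :
    (CSSCode.ofMatrices (rowMatrix 6 []) (rowMatrix 6 [])
      (comm_of_commOK (DistCert.commOK_of_check _ check_css_n6_k6))).IsCode 6 6 1 :=
  DistCert.isCode_code _ check_css_n6_k6 rankX_css_n6_k6 rankZ_css_n6_k6 (by decide)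

/-- `d^X = 1` for `css_n6_k6` (KERNEL-std). [folklore] -/
theorem dX_css_n6_k6 :
    (CSSCode.ofMatrices (rowMatrix 6 []) (rowMatrix 6 [])
      (comm_of_commOK (DistCert.commOK_of_check _ check_css_n6_k6))).dX = 1 :=
  DistCert.dX_code _ check_css_n6_k6

/-- `d^Z = 1` for `css_n6_k6` (KERNEL-std). [folklore] -/
theorem dZ_css_n6_k6 :
    (CSSCode.ofMatrices (rowMatrix 6 []) (rowMatrix 6 [])
      (comm_of_commOK (DistCert.commOK_of_check _ check_css_n6_k6))).dZ = 1 :=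
  DistCert.dZ_code _ check_css_n6_k6

end Summit.Ventures.QEC.Census.CSS
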